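import Summits.QuantumFields.BalabanUV.T4Continuum.Support.ShellMeasureLandauHolonomyClamp
import Summits.QuantumFields.BalabanUV.T4Continuum.Support.ShellMeasureLandauHolonomyWeight

/-!
# `T4Continuum.ShellMeasureLandauHolonomyWeightEnd` — THE S22 END WITH BOTH PLAQUETTE SIDES DEFINED: realized (M1) per
# slot (E2′) with the classifier holonomies `hol p` AND the Wilson weight words `G p` the words of read-outs of ONE
# canonical Landau exponent field; END-II's `hol`, `hcont`, `hRad`, `hAN` (SM-L1) and `G`, `hGW` (SM-L3) are no
# longer binders
(cell `pub-balaban`, sub-cell `t4`, spine estimate NE7c (node U5b); NE7c formalisation swarm, crew seat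
`b2b-balaban-t4-ne7c-formalise-leaf-02` gen 4 — file (C) of the OFFER «S22 ROAD, THE WEIGHT SIDE»; imports
`ShellMeasureLandauHolonomyClamp` (leaf-05-g4, p213068: E2′ with `hcont` on the cube) and this lineage's
`ShellMeasureLandauHolonomyWeight` (file (B)) ONLY; ONE theorem, 0 `def`, 0 `def … : Prop`, 0 sorry)

HONEST FRAMING.  Finite four-torus programme, rung (B)+1 only — NOT infinite volume, NOT a mass gap, NOT the Clay
problem, NOT summit progress; (B), `BetaPertHyp`, (B^μ) not consumed.  NE7c (`T4IndicatorShell.ShellWeightBound`) is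
NOT PRINTED and NOT PROVED; «NE7c ⇐ the named binders»; (M1) realized ≠ NE7c (trigger c3).  Nothing printed in
[Balaban1985Variational] is asserted.  This is a JUNCTION: no new estimate; its value is the binder list.

THE BINDER LIST (what the realized (M1) of one live slot costs on the S22 road after this file).  MEASURE SIDE (E2′,
unchanged): loop-free tree `T`, `U₀`, chart bonds `Λ`/`e`, window half-side `S` (`3S² < π²`), centres `c V`, block
weights `R V`, the gauge-invariant density `F` with its window factorisation `hFw` and finiteness `hfin`, the
gauge-invariant tested variable `u`.  DICTIONARIES (on the chart cube): `hRdict` — the block weight IS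
`Jco V · e^{−S}` with the Wilson part of `S` the words of WEIGHT read-outs `ℓw p` of the exponent field; `hudict` — the
tested variable IS the classifier of the words of CLASSIFIER read-outs `ℓs p` of the SAME field.  CO-TESTS `hJW`/`hJ`,
window `hWS : W V ⊆ closedBall 0 S`.  SM-L4 `hE`/`hB𝓔`.  NUMBERS + SM-L2 `hSM` at
`(Rad, H) = (r_Φ/S, e^{m·κ(z̄)} − 1)` + the weight smallness `hsw1 : m_w·κ_w·z̄ ≤ 1`, `z̄ = (ε₄+B₀b) + 4C₂B₀(ε₄+B₀b)²`.
THE S22 DATA per exterior section with V-UNIFORM constants: (P2) `h𝒢`; (P4) `hW`; (118)/(121) `hdom`/`hself`/`hcontr`;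
(103) `hH₁`; (75) `hΦd`/`hΦ0`/`hΦ`, `hSr : S < r_Φ`; (44)+[4] Prop. 7 `hCq`/`hCd`; scaling `hι`; (46) `hH`; (54)
`hq`/`hRC`; read-outs `ℓs` (`κ`, `m`) and `ℓw` (`κ_w`, `m_w`).  THE REAL STRUCTURE (file (A)): additive subgroups
`𝓡𝒴` (closed), `𝓡𝒵`, `𝓡𝒴′`, `𝓡𝒳` (closed), `𝓡ℬ`, preserved by the scheme maps of every `V`, `Φ V` real at real
chart points; the UNITARITY TYPE `hℓr` of the weight read-outs on `𝓡𝒴` ((176)).  CONCLUSION: E2′'s, literally, with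
the SM-L3 sizes `s̄ = m_w κ_w z̄`, `L̄ = 3 m_w κ_w z̄/(r_Φ/S − 1)`, `d̄ = 0` in its constant.

Proof: `ShellMeasureLandauHolonomyClamp.slotAC_realized_su2_of_levelData_cube_contOn` with `hcontOn :=
ShellMeasureLandauHolonomyContinuity.continuousOn_landauHol_chartRay`, `hAN := ShellMeasureLandauHolonomyChart.
hAN_landau_chartRay` (as in leaf-05-g4's `ShellMeasureLandauHolonomyEnd`) and `hGW := ShellMeasureLandauHolonomyWeight.
hGW_landau_chartRay`, per `V`.  NOT an instance of Bałaban's minimiser (every analytic input, the real structure and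
the unitarity type are binders); NE7c NOT PROVED; spine PROVED 0/9.  HONEST DEPENDENCY (cell): continuum YM on T⁴ ⇐
BetaPertH ∧ nine spine estimates (0/9 proved); BetaPertH ⇐ (D1) ∧ (D4) ∧ CAP+tail; G-an2-4 gates asym, D1 and NE2/3/4.
-/

noncomputable section

open Set Metric NormedSpace MeasureTheory Function

namespace Summit.QuantumFields.BalabanUV.T4Continuum.ShellMeasureLandauHolonomyWeightEnd

open scoped ENNReal
open Literature.MathematicalPhysics.QuantumFieldTheory.Balaban1983to89
open B11Prop6Scheme (Prop4Hyp)
open GaugeField (GaugeInvariant)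
open T4ShellMeasure (SlotAntiConcentration)
open T4CubePoincare (cube)
open T4CubeChartGnomonic (SU2)
open T4CubeChartExp (expWindowDensity expFibreChart)
open T4ShellMeasureDet (blockLaw)
open T4TreeGaugeFixing (NoClosedLoop fixTo)
open ShellMeasureWilsonTrace (TraceData)
open ShellMeasureLevelAssembly (classifier weight)
open ShellMeasureLandauHolonomy (solAt landauExp)
open ShellMeasureLandauHolonomyChart (holOf cplx hAN_landau_chartRay)
open ShellMeasureLandauHolonomyContinuity (continuousOn_landauHol_chartRay)
open ShellMeasureLandauHolonomyClamp (slotAC_realized_su2_of_levelData_cube_contOn)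
open ShellMeasureLandauHolonomyWeight (hGW_landau_chartRay)

variable {P : Params} {j : ℕ} [DecidableEq (PBond P j)]
variable {A : Type*} [NormedRing A] [NormedAlgebra ℂ A] [CompleteSpace A] [NormOneClass A]
variable {𝒴 𝒴' 𝒳 𝒵 ℬ : Type*} [NormedAddCommGroup 𝒴] [NormedSpace ℂ 𝒴] [CompleteSpace 𝒴]
  [NormedAddCommGroup 𝒴'] [NormedSpace ℂ 𝒴'] [NormedAddCommGroup 𝒳] [NormedSpace ℂ 𝒳] [CompleteSpace 𝒳]
  [NormedAddCommGroup 𝒵] [NormedSpace ℂ 𝒵] [NormedAddCommGroup ℬ] [NormedSpace ℂ ℬ]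

/-- **REALIZED (M1) PER SLOT (`G = SU(2)`) WITH BOTH PLAQUETTE SIDES DEFINED FROM THE CANONICAL LANDAU EXPONENT FIELD —
E2′ WITH `hol`, `hcont`, `hRad`, `hAN`, `G`, `hGW` NO LONGER BINDERS.**  See the module docstring for the binder list.
With `Z_V y := landauExp (Cf V) (ιs V) (Hop V) (4C₂(ε₄+B₀b)²) (solAt (𝒢 V) 0 (W𝒱 V) ε₄ 0 (H₁ V (Φ V (cplx y))) +
H₁ V (Φ V (cplx y)))` (written out below), the classifier holonomies are `holOf (ℓs p) Z_V` (inside `hudict`) and the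
weight words are `holOf (ℓw p) Z_V` (inside `hRdict`).  CONCLUSION: E2′'s
`SlotAntiConcentration ((fieldMeasure P j SU2).withDensity F) u θ ρ (2(n + β Σ_{p∈P_w} L̄(0 + 4 s̄) + B_𝓔)/(1−δ))`
with `s̄ = m_w κ_w z̄`, `L̄ = 3 m_w κ_w z̄/(r_Φ/S − 1)`.  A junction; CONDITIONAL on every binder; nothing PRINTED is
asserted; NOT Bałaban's minimiser. [folklore] -/
theorem slotAC_realized_su2_landauChart_twoSided {T : Finset (PBond P j)} (hT : NoClosedLoop T)
    (U₀ : GaugeField P j SU2) (Λ : Finset (PBond P j)) {n : ℕ} (e : ↥Λ × Fin 3 ≃ Fin n)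
    {S : ℝ} (hS : 0 < S) (hSπ : 3 * S ^ 2 < Real.pi ^ 2) (c : GaugeField P j SU2 → GaugeField P j SU2)
    {R : GaugeField P j SU2 → (↥Λ → SU2) → ℝ≥0∞} (hR : ∀ V, Measurable (R V))
    {F : GaugeField P j SU2 → ℝ≥0∞} (hF : Measurable F) (hFi : GaugeInvariant F)
    (hFw : ∀ V y, F (fixTo T U₀ (updateFinset V Λ y)) =
      ENNReal.ofReal (expWindowDensity Λ (c V) S (updateFinset (c V) Λ y)) * R V y)
    (hfin : ∀ V, ((blockLaw Λ).withDensity fun y => F (fixTo T U₀ (updateFinset V Λ y))) univ ≠ ∞)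
    {u : GaugeField P j SU2 → ℝ} (hu : Measurable u) (hui : GaugeInvariant u)
    -- level data per exterior section: trace datum, plaquette index sets, non-Wilson term, window, co-test
    (Ttr : TraceData A) (hN : 0 < Ttr.N) {ι κ : Type*} {Pu : Finset ι} (hPu : Pu.Nonempty) (Pw : Finset κ)
    (𝓔 : GaugeField P j SU2 → (Fin n → ℝ) → ℝ)
    (W : GaugeField P j SU2 → Set (Fin n → ℝ)) (Jco : GaugeField P j SU2 → (Fin n → ℝ) → ℝ≥0∞)
    {θ δ ρ β B𝓔 : ℝ}
    -- THE SCHEME DATA per exterior section (S22: (P2), (P4), (118)/(121), (103), (75), (44), scaling, (46), (54))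
    (𝒢 : GaugeField P j SU2 → (𝒵 →L[ℂ] 𝒴)) (W𝒱 : GaugeField P j SU2 → 𝒴 → 𝒵) {B₀ C₄ a₃ b ε₄ : ℝ}
    (h𝒢 : ∀ V f, ‖𝒢 V f‖ ≤ B₀ * ‖f‖) (hW : ∀ V, Prop4Hyp (W𝒱 V) C₄ a₃) (hB₀ : 0 < B₀) (hC₄ : 0 ≤ C₄)
    (hε₄ : 0 ≤ ε₄) (hdom : 2 * (ε₄ + B₀ * b) ≤ a₃) (hself : B₀ * C₄ * (ε₄ + B₀ * b) ^ 2 ≤ ε₄)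
    (hcontr : 4 * B₀ * C₄ * (ε₄ + B₀ * b) < 1)
    (H₁ : GaugeField P j SU2 → (ℬ →L[ℂ] 𝒴)) (hH₁ : ∀ V B, ‖H₁ V B‖ ≤ B₀ * ‖B‖)
    (Φ : GaugeField P j SU2 → (Fin n → ℂ) → ℬ) {rΦ : ℝ} (hΦd : ∀ V, DifferentiableOn ℂ (Φ V) (ball 0 rΦ))
    (hΦ0 : ∀ V, Φ V 0 = 0) (hΦ : ∀ V, ∀ z ∈ ball (0 : Fin n → ℂ) rΦ, ‖Φ V z‖ < b) (hSr : S < rΦ)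
    (Cf : GaugeField P j SU2 → 𝒴' → 𝒳) {C₂ RC : ℝ} (hC₂ : 0 ≤ C₂)
    (hCq : ∀ V, ∀ Z : 𝒴', ‖Z‖ < RC → ‖Cf V Z‖ ≤ C₂ * ‖Z‖ ^ 2) (hCd : ∀ V, DifferentiableOn ℂ (Cf V) (ball 0 RC))
    (ιs : GaugeField P j SU2 → (𝒴 →L[ℂ] 𝒴')) (hι : ∀ V Y, ‖ιs V Y‖ ≤ ‖Y‖)
    (Hop : GaugeField P j SU2 → (𝒳 →L[ℂ] 𝒴)) (hH : ∀ V X, ‖Hop V X‖ ≤ B₀ * ‖X‖)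
    (hq : 9 * C₂ * B₀ * (ε₄ + B₀ * b) < 1) (hRC : 3 * (ε₄ + B₀ * b) ≤ RC)
    -- the classifier read-outs (file 7″) and the WEIGHT read-outs (file (B))
    (ℓs : ι → List (𝒴 →L[ℂ] A)) {κr : ℝ} (hκ : 0 ≤ κr) (hℓ : ∀ p ∈ Pu, ∀ ℓ ∈ ℓs p, ∀ Y, ‖ℓ Y‖ ≤ κr * ‖Y‖)
    {m : ℕ} (hlen : ∀ p ∈ Pu, (ℓs p).length ≤ m)
    (ℓw : κ → List (𝒴 →L[ℂ] A)) {κw : ℝ} (hκw : 0 ≤ κw) (hℓw : ∀ p ∈ Pw, ∀ ℓ ∈ ℓw p, ∀ Y, ‖ℓ Y‖ ≤ κw * ‖Y‖)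
    {mw : ℕ} (hlenw : ∀ p ∈ Pw, (ℓw p).length ≤ mw)
    -- THE REAL STRUCTURE (file (A)) and the UNITARITY TYPE of the weight read-outs
    (𝓡𝒴 : AddSubgroup 𝒴) (h𝓡𝒴 : IsClosed (𝓡𝒴 : Set 𝒴)) (𝓡𝒵 : AddSubgroup 𝒵) (𝓡𝒴' : AddSubgroup 𝒴')
    (𝓡𝒳 : AddSubgroup 𝒳) (h𝓡𝒳 : IsClosed (𝓡𝒳 : Set 𝒳)) (𝓡ℬ : AddSubgroup ℬ)
    (h𝒢r : ∀ V, ∀ f ∈ 𝓡𝒵, 𝒢 V f ∈ 𝓡𝒴) (hWr : ∀ V, ∀ Y ∈ 𝓡𝒴, W𝒱 V Y ∈ 𝓡𝒵)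
    (hιr : ∀ V, ∀ Y ∈ 𝓡𝒴, ιs V Y ∈ 𝓡𝒴') (hHr : ∀ V, ∀ X ∈ 𝓡𝒳, Hop V X ∈ 𝓡𝒴)
    (hCr : ∀ V, ∀ Z ∈ 𝓡𝒴', Cf V Z ∈ 𝓡𝒳) (hH₁r : ∀ V, ∀ B ∈ 𝓡ℬ, H₁ V B ∈ 𝓡𝒴)
    (hΦr : ∀ V, ∀ y : Fin n → ℝ, ‖y‖ ≤ S → Φ V (cplx y) ∈ 𝓡ℬ)
    (hℓr : ∀ p ∈ Pw, ∀ ℓ ∈ ℓw p, ∀ Y ∈ 𝓡𝒴, Ttr.τ (ℓ Y) = 0 ∧ ‖exp (ℓ Y)‖ ≤ 1)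
    -- DICTIONARY (on the chart cube only): the block weight with the DEFINED weight words, the tested variable with the
    -- DEFINED classifier holonomies — both words of read-outs of the SAME exponent field
    (hRdict : ∀ V, ∀ x ∈ cube n S,
      R V (expFibreChart Λ (c V) e x) = Jco V x * weight Ttr β Pw
        (fun p => holOf (ℓw p) (fun y => landauExp (Cf V) (ιs V) (Hop V) (4 * C₂ * (ε₄ + B₀ * b) ^ 2)
          (solAt (𝒢 V) 0 (W𝒱 V) ε₄ (0 : 𝒵) (H₁ V (Φ V (cplx y))) + H₁ V (Φ V (cplx y))))) (𝓔 V) x)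
    (hudict : ∀ V, ∀ x ∈ cube n S,
      u (fixTo T U₀ (updateFinset V Λ (expFibreChart Λ (c V) e x))) =
        classifier hPu (fun p => holOf (ℓs p) (fun y => landauExp (Cf V) (ιs V) (Hop V)
          (4 * C₂ * (ε₄ + B₀ * b) ^ 2)
          (solAt (𝒢 V) 0 (W𝒱 V) ε₄ (0 : 𝒵) (H₁ V (Φ V (cplx y))) + H₁ V (Φ V (cplx y))))) x)
    -- SM-L5/L6: kept co-tests supported in the window, centre-monotone; the window inside the chart ball
    (hJW : ∀ V x, Jco V x ≠ 0 → x ∈ W V)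
    (hJ : ∀ V x, ∀ a : ℝ, 0 ≤ a → Jco V x ≤ Jco V (Real.exp (-a) • x))
    (hWS : ∀ V, W V ⊆ closedBall (0 : Fin n → ℝ) S)
    -- SM-L4 non-Wilson ray bound
    (hE : ∀ V, ∀ x ∈ W V, ∀ c' : ℝ, 1 / 2 ≤ c' → c' ≤ 1 → 𝓔 V (c' • x) ≤ 𝓔 V x + (1 - c') * B𝓔) (hB𝓔 : 0 ≤ B𝓔)
    -- numbers + the weight-side smallness `s̄ ≤ 1` + SM-L2 (SM) in the currency `Rad = r_Φ / S`
    (hθ : 0 < θ) (hδ0 : 0 ≤ δ) (hδ1 : δ < 1) (hρ0 : 0 ≤ ρ) (hρ : ρ ≤ (1 - δ) / 2) (hβ : 0 ≤ β)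
    (hsw1 : mw * (κw * ((ε₄ + B₀ * b) + B₀ * (4 * C₂ * (ε₄ + B₀ * b) ^ 2))) ≤ 1)
    (hSM : 36 * (Real.exp (m * (κr * ((ε₄ + B₀ * b) + B₀ * (4 * C₂ * (ε₄ + B₀ * b) ^ 2)))) - 1) * 1 ^ 2 /
      (rΦ / S - 1) ^ 2 ≤ δ * θ) :
    SlotAntiConcentration ((fieldMeasure P j SU2).withDensity F) u θ ρ
      (2 * ((n : ℝ) + (β * ∑ _p ∈ Pw,
        (mw * (3 * (κw * ((ε₄ + B₀ * b) + B₀ * (4 * C₂ * (ε₄ + B₀ * b) ^ 2))) / (rΦ / S - 1))) *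
          (0 + 4 * (mw * (κw * ((ε₄ + B₀ * b) + B₀ * (4 * C₂ * (ε₄ + B₀ * b) ^ 2))))) + B𝓔)) / (1 - δ)) := by
  have hRad : 1 < rΦ / S := by rw [lt_div_iff₀ hS]; linarith
  have hz : 0 ≤ (ε₄ + B₀ * b) + B₀ * (4 * C₂ * (ε₄ + B₀ * b) ^ 2) := by
    have hb : 0 < b := by
      obtain ⟨V⟩ : Nonempty (GaugeField P j SU2) := ⟨fun _ => 1⟩
      exact (norm_nonneg _).trans_lt (hΦ V 0 (mem_ball_self (hS.trans hSr)))
    have : 0 ≤ ε₄ + B₀ * b := by positivity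
    positivity
  have hs0 : 0 ≤ mw * (κw * ((ε₄ + B₀ * b) + B₀ * (4 * C₂ * (ε₄ + B₀ * b) ^ 2))) := by positivity
  have hL0 : 0 ≤ mw * (3 * (κw * ((ε₄ + B₀ * b) + B₀ * (4 * C₂ * (ε₄ + B₀ * b) ^ 2))) / (rΦ / S - 1)) :=
    mul_nonneg (Nat.cast_nonneg _) (div_nonneg (by positivity) (by linarith))
  refine slotAC_realized_su2_of_levelData_cube_contOn hT U₀ Λ e hS hSπ c hR hF hFi hFw hfin hu hui Ttr hN hPu
    (fun V p => holOf (ℓs p) (fun y => landauExp (Cf V) (ιs V) (Hop V) (4 * C₂ * (ε₄ + B₀ * b) ^ 2)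
      (solAt (𝒢 V) 0 (W𝒱 V) ε₄ (0 : 𝒵) (H₁ V (Φ V (cplx y))) + H₁ V (Φ V (cplx y)))))
    (fun V p _ => continuousOn_landauHol_chartRay hS (h𝒢 V) (hW V) hB₀ hC₄ hε₄ hdom hself hcontr (H₁ V) (hH₁ V)
      (hΦd V) (hΦ V) hSr hC₂ (hCq V) (hCd V) (ιs V) (hι V) (Hop V) (hH V) hq hRC (ℓs p))
    Pw
    (fun V p => holOf (ℓw p) (fun y => landauExp (Cf V) (ιs V) (Hop V) (4 * C₂ * (ε₄ + B₀ * b) ^ 2)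
      (solAt (𝒢 V) 0 (W𝒱 V) ε₄ (0 : 𝒵) (H₁ V (Φ V (cplx y))) + H₁ V (Φ V (cplx y)))))
    𝓔 W Jco
    (sw := fun _ => mw * (κw * ((ε₄ + B₀ * b) + B₀ * (4 * C₂ * (ε₄ + B₀ * b) ^ 2))))
    (lw := fun _ => mw * (3 * (κw * ((ε₄ + B₀ * b) + B₀ * (4 * C₂ * (ε₄ + B₀ * b) ^ 2))) / (rΦ / S - 1)))
    (dw := fun _ => 0)
    hRdict hudict hJW hJ hRad (fun V => ?_) (fun V => ?_) (fun _ _ => hsw1) (fun _ _ => hs0) (fun _ _ => hL0)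
    (fun _ _ => le_rfl) hE hB𝓔 hθ hδ0 hδ1 hρ0 hρ hβ hSM
  · exact hAN_landau_chartRay hS (hWS V) (h𝒢 V) (hW V) hB₀ hC₄ hε₄ hdom hself hcontr (H₁ V) (hH₁ V) (hΦd V)
      (hΦ0 V) (hΦ V) hSr hC₂ (hCq V) (hCd V) (ιs V) (hι V) (Hop V) (hH V) hq hRC ℓs hκ hℓ hlen
  · exact hGW_landau_chartRay Ttr hS (hWS V) (h𝒢 V) (hW V) hB₀ hC₄ hε₄ hdom hself hcontr (H₁ V) (hH₁ V) (hΦd V)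
      (hΦ0 V) (hΦ V) hSr hC₂ (hCq V) (hCd V) (ιs V) (hι V) (Hop V) (hH V) hq hRC ℓw hκw hℓw hlenw 𝓡𝒴 h𝓡𝒴 𝓡𝒵
      𝓡𝒴' 𝓡𝒳 h𝓡𝒳 𝓡ℬ (h𝒢r V) (hWr V) (hιr V) (hHr V) (hCr V) (hH₁r V) (hΦr V) hℓr

end Summit.QuantumFields.BalabanUV.T4Continuum.ShellMeasureLandauHolonomyWeightEnd
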